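import Mathlib
import Summits.NavierStokesRegularity.NavierStokesRegularity.Theses.FilamentSkeletonRss
import Literature.Analysis.FluidPDE.PineauVicolRDSSLeray
import Literature.Analysis.FluidPDE.IsometryInvariance
import Literature.Analysis.FluidPDE.AxisymNoSwirlVorticity

/-!
# Route FilamentSkeletonRss · crux `CoreGluing` (stmt-NavierStokesRegularity-15401) — line `Sketch`, tool stub `stub_profileRotationCovariance`

Helper file (theorems only) supporting the crux item; lands with `--supports stmt-NavierStokesRegularity-15401`.

Rotation covariance of Perelman's rotated Leray profile system (Pineau–Vicol, (1.8a–b);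
`J = rotGen = e₃ × ·`)

  `α(JU − DU[Jy]) + ½U + ½DU[y] − ΔU + DU[U] + ∇P = 0`, `∇·U = 0`,

under the rotations `R_θ = rotZ θ` about the axis `e₃`: if `(U, P)` is a smooth divergence-free
solution with the Type-I decay `‖U y‖ ≤ C₀/(1+‖y‖)` and a bounded pressure `|P| ≤ M`, then so is the
conjugated pair `U' = R_θ ∘ U ∘ R_{−θ}`, `P' = P ∘ R_{−θ}`, with the same constants.

Route of proof. `U'` is the conjugate of `U` by the linear isometry `R = rotZLIE θ` of `ℝ³`
(definitionally: `rotZLIE_apply`, `rotZLIE_symm_apply` are `rfl`), so every spatial term of the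
system at `y` is `R` applied to the corresponding term for `(U, P)` at `R⁻¹ y`
(`IsometryInvariance`: `fderiv_conj_linearIsometryEquiv`, `laplacian_conj_linearIsometryEquiv`,
`gradient_comp_linearIsometryEquiv_symm`, `VectorCalculus.IsDivFree.conj_linearIsometryEquiv`);
the rotation term `JU' − DU'[J·]` is covariant as well because `J` commutes with `R_θ`
(`rotGen_rotZ`, `profileRotationCovariance_rotTerm`). The decay bound
transfers by `‖R_θ v‖ = ‖v‖` (`norm_rotZ`).
-/

set_option linter.dupNamespace false

noncomputable section

namespace Summit.NavierStokesRegularity.NavierStokesRegularity.Theorems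

open Set Function Filter MeasureTheory
open Literature.Analysis.FluidPDE Literature.Analysis.FluidPDE.PineauVicol2026
open scoped RealInnerProductSpace Laplacian ContDiff Topology

/-- The rotation term of the profile system is rotation covariant: with `R = rotZLIE θ` (so that
`R⁻¹ = R_{−θ}`) and `U' = R ∘ U ∘ R⁻¹`, one has `J U'(y) − DU'(y)[J y] = R (J U(y') − DU(y')[J y'])`,
`y' = R⁻¹ y` (chain rule `DU'(y) = R ∘ DU(y') ∘ R⁻¹` and `J R_{±θ} = R_{±θ} J`). [folklore] -/
theorem profileRotationCovariance_rotTerm (θ : ℝ)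
    (U : EuclideanSpace ℝ (Fin 3) → EuclideanSpace ℝ (Fin 3)) (y : EuclideanSpace ℝ (Fin 3)) :
    rotGen (rotZLIE θ (U ((rotZLIE θ).symm y))) -
        fderiv ℝ (fun z => rotZLIE θ (U ((rotZLIE θ).symm z))) y (rotGen y) =
      rotZLIE θ (rotGen (U ((rotZLIE θ).symm y)) -
        fderiv ℝ U ((rotZLIE θ).symm y) (rotGen ((rotZLIE θ).symm y))) := by
  have e : (rotZLIE θ).symm (rotGen y) = rotGen ((rotZLIE θ).symm y) :=
    (rotGen_rotZ (-θ) y).symm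
  rw [fderiv_conj_linearIsometryEquiv, map_sub]
  show rotGen (rotZ θ (U ((rotZLIE θ).symm y))) -
      rotZLIE θ (fderiv ℝ U ((rotZLIE θ).symm y) ((rotZLIE θ).symm (rotGen y))) = _
  rw [e, rotGen_rotZ]
  rfl

/-- **The profile system is rotation covariant** (conjugate form). If `(U, P)` solves
`α(JU − DU[Jy]) + ½U + ½DU[y] − ΔU + DU[U] + ∇P = 0` everywhere, then so does the pair
`(R ∘ U ∘ R⁻¹, P ∘ R⁻¹)`, `R = rotZLIE θ`: at `y` every term is `R` applied to the corresponding term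
for `(U, P)` at `R⁻¹ y` (Majda–Bertozzi, §1.2, Prop. 1.1 (iii), rotation symmetry of the operators,
and `profileRotationCovariance_rotTerm` for the rotation term), and `R 0 = 0`. [folklore] -/
theorem profileRotationCovariance_momentum {α : ℝ} (θ : ℝ)
    {U : EuclideanSpace ℝ (Fin 3) → EuclideanSpace ℝ (Fin 3)} {P : EuclideanSpace ℝ (Fin 3) → ℝ}
    (heq : ∀ y : EuclideanSpace ℝ (Fin 3), α • (rotGen (U y) - fderiv ℝ U y (rotGen y)) +
      (1 / 2 : ℝ) • U y + (1 / 2 : ℝ) • fderiv ℝ U y y - (Δ U) y + fderiv ℝ U y (U y) +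
      gradient P y = 0)
    (y : EuclideanSpace ℝ (Fin 3)) :
    α • (rotGen (rotZLIE θ (U ((rotZLIE θ).symm y))) -
          fderiv ℝ (fun z => rotZLIE θ (U ((rotZLIE θ).symm z))) y (rotGen y)) +
        (1 / 2 : ℝ) • rotZLIE θ (U ((rotZLIE θ).symm y)) +
        (1 / 2 : ℝ) • fderiv ℝ (fun z => rotZLIE θ (U ((rotZLIE θ).symm z))) y y -
        (Δ fun z => rotZLIE θ (U ((rotZLIE θ).symm z))) y +
        fderiv ℝ (fun z => rotZLIE θ (U ((rotZLIE θ).symm z))) y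
          (rotZLIE θ (U ((rotZLIE θ).symm y))) +
        gradient (fun z => P ((rotZLIE θ).symm z)) y = 0 := by
  -- the drift term `DU'(y)[y] = R (DU(y')[y'])`
  have hD : fderiv ℝ (fun z => rotZLIE θ (U ((rotZLIE θ).symm z))) y y =
      rotZLIE θ (fderiv ℝ U ((rotZLIE θ).symm y) ((rotZLIE θ).symm y)) := by
    rw [fderiv_conj_linearIsometryEquiv]
    rfl
  -- the convective term `DU'(y)[U'(y)] = R (DU(y')[U(y')])`
  have hC : fderiv ℝ (fun z => rotZLIE θ (U ((rotZLIE θ).symm z))) y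
      (rotZLIE θ (U ((rotZLIE θ).symm y))) =
      rotZLIE θ (fderiv ℝ U ((rotZLIE θ).symm y) (U ((rotZLIE θ).symm y))) := by
    rw [fderiv_conj_linearIsometryEquiv]
    show rotZLIE θ (fderiv ℝ U ((rotZLIE θ).symm y)
      ((rotZLIE θ).symm (rotZLIE θ (U ((rotZLIE θ).symm y))))) = _
    rw [(rotZLIE θ).symm_apply_apply]
  -- the profile system at `y' = R⁻¹ y`, pushed through `R`
  have key : rotZLIE θ (α • (rotGen (U ((rotZLIE θ).symm y)) -
      fderiv ℝ U ((rotZLIE θ).symm y) (rotGen ((rotZLIE θ).symm y))) +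
      (1 / 2 : ℝ) • U ((rotZLIE θ).symm y) +
      (1 / 2 : ℝ) • fderiv ℝ U ((rotZLIE θ).symm y) ((rotZLIE θ).symm y) -
      (Δ U) ((rotZLIE θ).symm y) + fderiv ℝ U ((rotZLIE θ).symm y) (U ((rotZLIE θ).symm y)) +
      gradient P ((rotZLIE θ).symm y)) = 0 := by
    rw [heq, map_zero]
  rw [profileRotationCovariance_rotTerm, hD, hC, gradient_comp_linearIsometryEquiv_symm,
    laplacian_conj_linearIsometryEquiv]
  simpa only [map_add, map_sub, LinearIsometryEquiv.map_smul] using key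

/-- Rotation covariance of the rotated Leray profile system about the axis `e₃`: if `(U, P)` is a
smooth divergence-free solution of `α(JU − DU[Jy]) + ½U + ½DU[y] − ΔU + DU[U] + ∇P = 0` with
`‖U y‖ ≤ C₀/(1+‖y‖)` and `|P| ≤ M`, then so is `(R_θ ∘ U ∘ R_{−θ}, P ∘ R_{−θ})` with the same
constants: the conjugated pair is `(R ∘ U ∘ R⁻¹, P ∘ R⁻¹)` for the linear isometry `R = rotZLIE θ`
(definitionally), smoothness and incompressibility are preserved by conjugation
(`VectorCalculus.IsDivFree.conj_linearIsometryEquiv`), the system by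
`profileRotationCovariance_momentum`, and the bounds by `‖R_{±θ} v‖ = ‖v‖` (Majda–Bertozzi, §1.2,
Prop. 1.1 (iii), rotation symmetry). [folklore] -/
theorem stub_profileRotationCovariance :
    ∀ (α θ C₀ M : ℝ) (U : EuclideanSpace ℝ (Fin 3) → EuclideanSpace ℝ (Fin 3)) (P : EuclideanSpace ℝ (Fin 3) → ℝ),
      ContDiff ℝ (⊤ : ℕ∞) U → ContDiff ℝ (⊤ : ℕ∞) P → VectorCalculus.IsDivFree U →
      (∀ y : EuclideanSpace ℝ (Fin 3), α • (rotGen (U y) - fderiv ℝ U y (rotGen y)) + (1 / 2 : ℝ) • U y +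
        (1 / 2 : ℝ) • fderiv ℝ U y y - (Δ U) y + fderiv ℝ U y (U y) + gradient P y = 0) →
      (∀ y : EuclideanSpace ℝ (Fin 3), ‖U y‖ ≤ C₀ / (1 + ‖y‖)) →
      (∀ y : EuclideanSpace ℝ (Fin 3), |P y| ≤ M) →
      ContDiff ℝ (⊤ : ℕ∞) (fun y => rotZ θ (U (rotZ (-θ) y))) ∧
      ContDiff ℝ (⊤ : ℕ∞) (fun y => P (rotZ (-θ) y)) ∧
      VectorCalculus.IsDivFree (fun y => rotZ θ (U (rotZ (-θ) y))) ∧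
      (∀ y : EuclideanSpace ℝ (Fin 3),
        α • (rotGen (rotZ θ (U (rotZ (-θ) y))) - fderiv ℝ (fun y => rotZ θ (U (rotZ (-θ) y))) y (rotGen y)) +
          (1 / 2 : ℝ) • rotZ θ (U (rotZ (-θ) y)) + (1 / 2 : ℝ) • fderiv ℝ (fun y => rotZ θ (U (rotZ (-θ) y))) y y -
          (Δ (fun y => rotZ θ (U (rotZ (-θ) y)))) y +
          fderiv ℝ (fun y => rotZ θ (U (rotZ (-θ) y))) y (rotZ θ (U (rotZ (-θ) y))) +
          gradient (fun y => P (rotZ (-θ) y)) y = 0) ∧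
      (∀ y : EuclideanSpace ℝ (Fin 3), ‖rotZ θ (U (rotZ (-θ) y))‖ ≤ C₀ / (1 + ‖y‖)) ∧
      (∀ y : EuclideanSpace ℝ (Fin 3), |P (rotZ (-θ) y)| ≤ M) := by
  intro α θ C₀ M U P hU hP hdiv heq hdec hPM
  -- the conjugated pair is `(R ∘ U ∘ R⁻¹, P ∘ R⁻¹)` with `R = rotZLIE θ`, definitionally
  have hconjU : (fun y => rotZ θ (U (rotZ (-θ) y))) =
      fun y => rotZLIE θ (U ((rotZLIE θ).symm y)) := rfl
  have hconjP : (fun y => P (rotZ (-θ) y)) = fun y => P ((rotZLIE θ).symm y) := rfl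
  refine ⟨?_, ?_, ?_, fun y => profileRotationCovariance_momentum θ heq y, fun y => ?_,
    fun y => hPM _⟩
  · -- smoothness of the velocity
    rw [hconjU]
    exact (rotZLIE θ).toContinuousLinearEquiv.contDiff.comp
      (hU.comp (rotZLIE θ).symm.toContinuousLinearEquiv.contDiff)
  · -- smoothness of the pressure
    rw [hconjP]
    exact hP.comp (rotZLIE θ).symm.toContinuousLinearEquiv.contDiff
  · -- incompressibility
    rw [hconjU]
    exact hdiv.conj_linearIsometryEquiv (rotZLIE θ)
  · -- the Type-I decay bound (`‖R_θ v‖ = ‖v‖`, `‖R_{−θ} y‖ = ‖y‖`)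
    rw [norm_rotZ]
    simpa only [norm_rotZ] using hdec (rotZ (-θ) y)

end Summit.NavierStokesRegularity.NavierStokesRegularity.Theorems
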